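import Summits.CriticalPhenomena.PercolationContinuityZ3.Theorems.PercNearOneGluingAdditiveGluingBlockKernelMix
import HarnessLib

/-! # Crux `PercNearOneGluing.AdditiveGluing` (stmt-CriticalPhenomena-4576), residual kernel — the GOOD-NEIGHBOUR leaf
# (invested seat xfam-a)

Support file for the open residual of `goodStep_of_residualKernel`; lands `--supports stmt-CriticalPhenomena-4576`; no
definitions, no named facts.  `BK(u, A, S, b, a₀, sel)` is the block kernel written as in `…BlockKernelMix.lean`.

* `real_openConn_le_of_weight_one`: a weight-`1` pair `s(s, y)` (`s ≠ y`) is a.s. open, so `μ(y ↔ b) ≤ μ(s ↔ b)`.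
* `blockKernel_of_goodNeighbour` (**stripping one block pair**): for `s ∈ S ∌ b`, a vertex `y ≠ s` and the pair
  `f = s(s, y)`: if `y` is at least as reliable as `a₀` in the weighting `u[f ↦ 1]` and `BK` holds for `u[f ↦ 0]`, then
  `BK` holds for `u`.  (Edge mixture `blockKernel_of_update`; the endpoint `f ↦ 1` is Kozma–Nitzan's Lemma 5 through
  `s ≡ y`, `blockGood_leaf_lemma5`.)  Iterating strips every pair from the block to a good vertex.
* `blockKernel_of_pairAtRelay_ih` (**a closed class of the residual, inside the current architecture**): if the designated
  relay `a₀` itself is joined to the block by a pair `f = s(s, a₀)` such that, after DELETING `f`, `a₀` is still a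
  minimiser of the glued two-point function `μ_{u[f↦0]/S}(· ↔ b)` and the glued quadruple `(u[f↦0]/S, A, s₀, b)` is good
  (an induction-hypothesis instance), then `BK(u, A, S, b, a₀, sel)`.  This contains the tight "pendant hub" family of the
  numerics (a block vertex hanging on `a₀`): deleting the pendant pair changes no relay's two-point function.
[cite: KozmaNitzan2024, §3.2 (Lemma 5 p. 13, Thms 4–5 pp. 12–14), §5.3 p. 34]
-/

namespace Summit.CriticalPhenomena.PercolationContinuityZ3.Theorems

open MeasureTheory Set
open Literature.Probability.LatticeModels (prodBernoulli)
open Literature.Probability.Percolation (BondConfig openConn openConnIn openGraph openCluster)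
open scoped BigOperators

noncomputable section
open Classical

section GoodNeighbour

open Literature.Probability.LatticeModels Literature.Probability.Percolation

variable {n : ℕ}

/-- A pair of weight `1` is almost surely open, so its far end is at most as reliable as its near end:
`u s(s,y) = 1`, `s ≠ y` ⟹ `μ_u(y ↔ b) ≤ μ_u(s ↔ b)`. [folklore; cite: Grimmett1999, §1.3 p. 10] -/
theorem real_openConn_le_of_weight_one (u : Sym2 (Fin n) → unitInterval) (s y b : Fin n) (hsy : s ≠ y)
    (h1 : u s(s, y) = 1) :
    (prodBernoulli u).real (openConn y b) ≤ (prodBernoulli u).real (openConn s b) := by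
  have hae : ∀ᵐ ω ∂(prodBernoulli u), ω ∈ (openConn y b : Set (BondConfig (Fin n))) → ω ∈ openConn s b := by
    filter_upwards [prodBernoulli_ae_mem_of_eq_one u h1] with ω hω hyb
    exact (SimpleGraph.Adj.reachable ((openGraph_adj ω s y).2 ⟨hω, hsy⟩)).trans hyb
  exact ENNReal.toReal_mono (measure_ne_top _ _) (measure_mono_ae hae)

/-- **Stripping one block pair (the good-neighbour leaf).**  Let `s ∈ S ∌ b`, `y ≠ s`, `f = s(s, y)`.  If `y` is at least
as reliable as the designated relay `a₀` in `u[f ↦ 1]` and the block kernel holds for `u[f ↦ 0]`, then it holds for `u`.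
[cite: KozmaNitzan2024, §3.2 Lemma 5 (p. 13), §5.3 p. 34] -/
theorem blockKernel_of_goodNeighbour (u : Sym2 (Fin n) → unitInterval) (A S : Finset (Fin n)) (b a₀ s y : Fin n)
    (sel : Finset (Fin n) → Fin n) (hs : s ∈ S) (hbS : b ∉ S) (hsy : s ≠ y)
    (hgood : (prodBernoulli (Function.update u s(s, y) 1)).real (openConn a₀ b) ≤
      (prodBernoulli (Function.update u s(s, y) 1)).real (openConn y b))
    (h0 : (prodBernoulli (Function.update u s(s, y) 0)).real (openConn a₀ b)
        + (prodBernoulli (Function.update u s(s, y) 0)).real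
            ((openConn a₀ b)ᶜ ∩ (⋃ s ∈ S, openConn a₀ s) ∩ (⋃ s ∈ S, openConn s b))
      ≤ (prodBernoulli (Function.update u s(s, y) 0)).real (⋃ s ∈ S, openConn s b)
        + ∑ W ∈ (Finset.univ : Finset (Finset (Fin n))).filter (fun W => Disjoint W A),
            (prodBernoulli (Function.update u s(s, y) 0)).real
                {ω : BondConfig (Fin n) | ∀ z : Fin n, (z ∈ W ↔ ω ∈ ⋃ s ∈ S, openConn s z)}
              * (prodBernoulli (Function.update u s(s, y) 0)).real (openConnIn ((W : Set (Fin n))ᶜ) (sel W) b)) :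
    (prodBernoulli u).real (openConn a₀ b)
        + (prodBernoulli u).real ((openConn a₀ b)ᶜ ∩ (⋃ s ∈ S, openConn a₀ s) ∩ (⋃ s ∈ S, openConn s b))
      ≤ (prodBernoulli u).real (⋃ s ∈ S, openConn s b)
        + ∑ W ∈ (Finset.univ : Finset (Finset (Fin n))).filter (fun W => Disjoint W A),
            (prodBernoulli u).real {ω : BondConfig (Fin n) | ∀ z : Fin n, (z ∈ W ↔ ω ∈ ⋃ s ∈ S, openConn s z)}
              * (prodBernoulli u).real (openConnIn ((W : Set (Fin n))ᶜ) (sel W) b) := by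
  refine blockKernel_of_update u A S b a₀ sel s(s, y) ⟨s, hs⟩ ?_ h0
  refine blockGood_leaf_lemma5 (Function.update u s(s, y) 1) A S b a₀ s sel hs hbS (hgood.trans ?_)
  exact real_openConn_le_of_weight_one _ s y b hsy (Function.update_self _ _ _)

/-- **A closed class of the residual: the designated relay hangs on the block by a deletable pair.**  Let `s, s₀ ∈ S ∌ b`,
`b ∈ A`, `f = s(s, a₀)` with `s ≠ a₀`.  If after deleting `f` the designated relay `a₀` is still a minimiser of the
GLUED two-point function `μ_{u[f↦0]/S}(· ↔ b)` over `A`, and the glued quadruple `(u[f↦0]/S, A, s₀, b)` is GOOD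
(selection form, all levels and selections — an induction-hypothesis instance of `stub_goodStep`, one positive-degree
vertex down), then `BK(u, A, S, b, a₀, sel)`.  Proof: `blockKernel_of_goodNeighbour` with `y = a₀` (the good-neighbour
hypothesis is `le_rfl`) and `blockGood_leaf_ih` at the deleted endpoint. [cite: KozmaNitzan2024, §3.2 (Thms 4–5, pp. 12–14)] -/
theorem blockKernel_of_pairAtRelay_ih (u : Sym2 (Fin n) → unitInterval) (A S : Finset (Fin n)) (b a₀ s s₀ : Fin n)
    (sel : Finset (Fin n) → Fin n) (hs : s ∈ S) (hs₀ : s₀ ∈ S) (hbS : b ∉ S) (hbA : b ∈ A) (hsa : s ≠ a₀)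
    (hsel : ∀ W, sel W ∈ A)
    (hmin : ∀ a ∈ A, (prodBernoulli (fun e : Sym2 (Fin n) =>
        if (∀ x ∈ e, x ∈ S) ∧ ¬ e.IsDiag then 1 else Function.update u s(s, a₀) 0 e)).real (openConn a₀ b) ≤
      (prodBernoulli (fun e : Sym2 (Fin n) =>
        if (∀ x ∈ e, x ∈ S) ∧ ¬ e.IsDiag then 1 else Function.update u s(s, a₀) 0 e)).real (openConn a b))
    (hgood : ∀ (t : ℝ) (sel' : Finset (Fin n) → Fin n), (∀ W, sel' W ∈ A) →
      (∀ a ∈ A, 1 - t ≤ (prodBernoulli (fun e : Sym2 (Fin n) =>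
        if (∀ x ∈ e, x ∈ S) ∧ ¬ e.IsDiag then 1 else Function.update u s(s, a₀) 0 e)).real (openConn a b)) →
      (prodBernoulli (fun e : Sym2 (Fin n) =>
          if (∀ x ∈ e, x ∈ S) ∧ ¬ e.IsDiag then 1 else Function.update u s(s, a₀) 0 e)).real
          ((⋃ a ∈ A, openConn s₀ a) ∩ (openConn s₀ b)ᶜ)
        + ∑ W ∈ (Finset.univ : Finset (Finset (Fin n))).filter (fun W => s₀ ∈ W ∧ Disjoint W A),
            (prodBernoulli (fun e : Sym2 (Fin n) =>
                if (∀ x ∈ e, x ∈ S) ∧ ¬ e.IsDiag then 1 else Function.update u s(s, a₀) 0 e)).real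
                {ω : BondConfig (Fin n) | openCluster ω s₀ = (W : Set (Fin n))}
              * (prodBernoulli (fun e : Sym2 (Fin n) =>
                  if (∀ x ∈ e, x ∈ S) ∧ ¬ e.IsDiag then 1 else Function.update u s(s, a₀) 0 e)).real
                  (openConnIn ((W : Set (Fin n))ᶜ) (sel' W) b)ᶜ ≤ t) :
    (prodBernoulli u).real (openConn a₀ b)
        + (prodBernoulli u).real ((openConn a₀ b)ᶜ ∩ (⋃ s ∈ S, openConn a₀ s) ∩ (⋃ s ∈ S, openConn s b))
      ≤ (prodBernoulli u).real (⋃ s ∈ S, openConn s b)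
        + ∑ W ∈ (Finset.univ : Finset (Finset (Fin n))).filter (fun W => Disjoint W A),
            (prodBernoulli u).real {ω : BondConfig (Fin n) | ∀ z : Fin n, (z ∈ W ↔ ω ∈ ⋃ s ∈ S, openConn s z)}
              * (prodBernoulli u).real (openConnIn ((W : Set (Fin n))ᶜ) (sel W) b) :=
  blockKernel_of_goodNeighbour u A S b a₀ s a₀ sel hs hbS hsa le_rfl
    (blockGood_leaf_ih (Function.update u s(s, a₀) 0) A S b a₀ s₀ sel hs₀ hbA hsel hmin hgood)

end GoodNeighbour

open Literature.Probability.LatticeModels Literature.Probability.Percolation in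
/-- Registered helper stub `stub_blockKernelGoodNeighbour_xfa` (invested seat xfam-a): stripping one block pair towards a good vertex
(= `blockKernel_of_goodNeighbour`). [cite: KozmaNitzan2024, §3.2 Lemma 5 (p. 13)] -/
theorem stub_blockKernelGoodNeighbour_xfa : ∀ (n : ℕ) (u : Sym2 (Fin n) → unitInterval) (A S : Finset (Fin n)) (b a₀ s y : Fin n) (sel : Finset (Fin n) → Fin n), s ∈ S → b ∉ S → s ≠ y → (prodBernoulli (Function.update u s(s, y) 1)).real (openConn a₀ b) ≤ (prodBernoulli (Function.update u s(s, y) 1)).real (openConn y b) → ((prodBernoulli (Function.update u s(s, y) 0)).real (openConn a₀ b) + (prodBernoulli (Function.update u s(s, y) 0)).real ((openConn a₀ b)ᶜ ∩ (⋃ s ∈ S, openConn a₀ s) ∩ (⋃ s ∈ S, openConn s b)) ≤ (prodBernoulli (Function.update u s(s, y) 0)).real (⋃ s ∈ S, openConn s b) + ∑ W ∈ (Finset.univ : Finset (Finset (Fin n))).filter (fun W => Disjoint W A), (prodBernoulli (Function.update u s(s, y) 0)).real {ω : BondConfig (Fin n) | ∀ z : Fin n, (z ∈ W ↔ ω ∈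 ⋃ s ∈ S, openConn s z)} * (prodBernoulli (Function.update u s(s, y) 0)).real (openConnIn ((W : Set (Fin n))ᶜ) (sel W) b)) → (prodBernoulli u).real (openConn a₀ b) + (prodBernoulli u).real ((openConn a₀ b)ᶜ ∩ (⋃ s ∈ S, openConn a₀ s) ∩ (⋃ s ∈ S, openConn s b)) ≤ (prodBernoulli u).real (⋃ s ∈ S, openConn s b) + ∑ W ∈ (Finset.univ : Finset (Finset (Fin n))).filter (fun W => Disjoint W A), (prodBernoulli u).real {ω : BondConfig (Fin n) | ∀ z : Fin n, (z ∈ W ↔ ω ∈ ⋃ s ∈ S, openConn s z)} * (prodBernoulli u).real (openConnIn ((W : Set (Fin n))ᶜ) (sel W) b) :=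
  fun _ u A S b a₀ s y sel hs hbS hsy hgood h0 => blockKernel_of_goodNeighbour u A S b a₀ s y sel hs hbS hsy hgood h0

open Literature.Probability.LatticeModels Literature.Probability.Percolation in
/-- Registered helper stub `stub_blockKernelPairAtRelay_xfa` (invested seat xfam-a): the residual kernel's closed class "designated relay
hangs on the block by a deletable pair" (= `blockKernel_of_pairAtRelay_ih`). [cite: KozmaNitzan2024, §3.2 (Thms 4–5, pp. 12–14)] -/
theorem stub_blockKernelPairAtRelay_xfa : ∀ (n : ℕ) (u : Sym2 (Fin n) → unitInterval) (A S : Finset (Fin n)) (b a₀ s s₀ : Fin n) (sel : Finset (Fin n) → Fin n), s ∈ S → s₀ ∈ S → b ∉ S → b ∈ A → s ≠ a₀ → (∀ W, sel W ∈ A) → (∀ a ∈ A, (prodBernoulli (fun e : Sym2 (Fin n) => if (∀ x ∈ e, x ∈ S) ∧ ¬ e.IsDiag then 1 else Function.update u s(s, a₀) 0 e)).real (openConn a₀ b) ≤ (prodBernoulli (fun e : Sym2 (Fin n) => if (∀ x ∈ e, x ∈ S) ∧ ¬ e.IsDiag then 1 else Function.update u s(s, a₀) 0 e)).real (openConn a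 b)) → (∀ (t : ℝ) (sel' : Finset (Fin n) → Fin n), (∀ W, sel' W ∈ A) → (∀ a ∈ A, 1 - t ≤ (prodBernoulli (fun e : Sym2 (Fin n) => if (∀ x ∈ e, x ∈ S) ∧ ¬ e.IsDiag then 1 else Function.update u s(s, a₀) 0 e)).real (openConn a b)) → (prodBernoulli (fun e : Sym2 (Fin n) => if (∀ x ∈ e, x ∈ S) ∧ ¬ e.IsDiag then 1 else Function.update u s(s, a₀) 0 e)).real ((⋃ a ∈ A, openConn s₀ a) ∩ (openConn s₀ b)ᶜ) + ∑ W ∈ (Finset.univ : Finset (Finset (Fin n))).filter (fun W => s₀ ∈ W ∧ Disjoint W A), (prodBernoulli (fun e : Sym2 (Fin n) => if (∀ x ∈ e, x ∈ S) ∧ ¬ e.IsDiag then 1 else Function.update u s(s, a₀) 0 e)).real {ω : BondConfig (Fin n) | openCluster ω s₀ = (W : Set (Fin n))} * (prodBernoulli (fun e : Sym2 (Fin n) => if (∀ x ∈ e, x ∈ S) ∧ ¬ e.IsDiag then 1 else Function.update u s(s, a₀) 0 e)).real (openConnIn ((W : Set (Fin n))ᶜ) (sel' W) b)ᶜ ≤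 t) → (prodBernoulli u).real (openConn a₀ b) + (prodBernoulli u).real ((openConn a₀ b)ᶜ ∩ (⋃ s ∈ S, openConn a₀ s) ∩ (⋃ s ∈ S, openConn s b)) ≤ (prodBernoulli u).real (⋃ s ∈ S, openConn s b) + ∑ W ∈ (Finset.univ : Finset (Finset (Fin n))).filter (fun W => Disjoint W A), (prodBernoulli u).real {ω : BondConfig (Fin n) | ∀ z : Fin n, (z ∈ W ↔ ω ∈ ⋃ s ∈ S, openConn s z)} * (prodBernoulli u).real (openConnIn ((W : Set (Fin n))ᶜ) (sel W) b) :=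
  fun _ u A S b a₀ s s₀ sel hs hs₀ hbS hbA hsa hsel hmin hgood =>
    blockKernel_of_pairAtRelay_ih u A S b a₀ s s₀ sel hs hs₀ hbS hbA hsa hsel hmin hgood

end

end Summit.CriticalPhenomena.PercolationContinuityZ3.Theorems
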